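import Literature.RingTheory.FittingIdeal.Basic
import Mathlib.RingTheory.Kaehler.Basic
import Mathlib.RingTheory.Filtration
import Mathlib.RingTheory.Nakayama
import Mathlib.RingTheory.AdicCompletion.LocalRing
import Mathlib.RingTheory.MvPowerSeries.Inverse
import Mathlib.LinearAlgebra.Matrix.Notation
import HarnessLib

/-!
# The first Fitting ideal of `Ω` at an ordinary double point is the maximal ideal (Stacks 0C4D)

Topic: `Literature/AlgebraicGeometry/Resolution`. Local algebra behind de Jong 1996, 2.21 ("Let
`Sing(f) ⊂ X` be the closed subscheme defined by the first Fitting ideal of the sheaf `Ω_{X/S}`.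
The morphism `Sing(f) → S` is finite, unramified and of finite presentation") at the points of a
GEOMETRIC fibre, i.e. over an algebraically closed field `K` — The Stacks Project, Tag 0C4D
(1) ⇒ (4): at a node `x` of a `1`-dimensional algebraic `k`-scheme "the first Fitting ideal of
`Ω_{X/k}` generates `𝔪_x` in `𝒪_{X,x}`". The tree renders an ordinary double point through its
complete local ring (`IsOrdinaryDoublePoint K x`: a RING isomorphism `𝒪̂_{C,x} ≃+* K⟦u, v⟧/(uv)`,
`AlterationsSemiStable.lean`), so the statement proved here is about a Noetherian local
`K`-algebra `(B, 𝔪)` with residue field `K` (every `b ∈ B` is `λ + x`, `λ ∈ K`, `x ∈ 𝔪`) and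
`Ω_{B/K}` finite (e.g. `B` essentially of finite type over `K`). Everything is PROVED:

* `Derivation.apply_mem_pow_smul_top` — `D(Iⁿ⁺¹) ⊆ Iⁿ Ω` for any derivation (Leibniz);
* `KaehlerDifferential.span_range_D_eq_top_of_maximalIdeal_eq_span` — if `𝔪 = (g₁, …, g_k)` then
  `Ω_{B/K} = Σ B dgᵢ` (every `b = λ + Σ aᵢ gᵢ` has `db ∈ Σ B dgᵢ + 𝔪 Ω`; Nakayama);
  hence `Module.fittingIdeal_kaehler_eq_top_of_maximalIdeal_eq_span` — **`Fitt_k(Ω_{B/K}) = B`**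
  (the case `k = 1`: a nonsingular point of a curve over `K = K̄` is not in `Sing`);
* `maximalIdeal_le_fittingIdeal_kaehler_of_approxNode` — **if for every `n` there are `u, v` with
  `𝔪 = (u, v)` and `uv ∈ 𝔪ⁿ`, then `𝔪 ⊆ Fitt₁(Ω_{B/K})`**: `d(uv) = u dv + v du ∈ 𝔪ⁿ⁻¹Ω =
  𝔪ⁿ⁻¹(B du + B dv)`, so `(v - α) du + (u - β) dv = 0` with `α, β ∈ 𝔪ⁿ⁻¹` is a relation among the
  two generators `du, dv`, whose `1 × 1` minors `v - α`, `u - β` lie in `Fitt₁`; thus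
  `𝔪 ⊆ Fitt₁ + 𝔪ⁿ⁻¹` for all `n`, and `⋂ₙ (Fitt₁ + 𝔪ⁿ) = Fitt₁` (Krull's intersection theorem);
* `exists_approxNode_of_ringEquiv_adicCompletion` — **the hypothesis holds at an ordinary double
  point**: from a ring isomorphism `B̂ ≃+* K⟦u, v⟧/(uv)` (`B̂` the `𝔪`-adic completion), for every
  `n` there are `u, v ∈ B` with `𝔪 = (u, v)` and `uv ∈ 𝔪ⁿ` (approximate the images of `u, v` in
  `B̂ = lim B/𝔪ⁿ` modulo `𝔪ⁿB̂`; `𝔪B̂ = 𝔪_{B̂}`, Mathlib `AdicCompletion.maximalIdeal_eq_map`; Nakayama);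
  no `K`-algebra structure on the isomorphism is needed;
* `maximalIdeal_le_fittingIdeal_kaehler_of_ringEquiv_adicCompletion` — the two combined:
  **Stacks 0C4D (1) ⇒ (4) over `K = K̄`** in the form used for `IsOrdinaryDoublePoint`.

## Sources

* The Stacks Project, Tag 0C4D ((1) ⇒ (4)), Tag 0C3I. [StacksProject]
* A. J. de Jong, *Smoothness, semi-stability and alterations*, Publ. Math. IHÉS 83 (1996), 2.21,
  2.23 (pp. 61–62). [DeJong1996]
* D. Eisenbud, *Commutative Algebra*, GTM 150 (1995), §20.2 (Fitting ideals), §16.1.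
-/

namespace Literature.AlgebraicGeometry.Resolution

open IsLocalRing Literature.RingTheory.FittingIdeal

universe u v w

/-! ## Derivations lower the `I`-adic order by at most one -/

/-- For a derivation `D : B → M` and an ideal `I ⊆ B`: `D(Iⁿ⁺¹) ⊆ Iⁿ M` (Leibniz rule).
[folklore] -/
theorem Derivation.apply_mem_pow_smul_top {K : Type u} {B : Type v} {M : Type w} [CommRing K]
    [CommRing B] [Algebra K B] [AddCommGroup M] [Module B M] [Module K M] [IsScalarTower K B M]
    (D : Derivation K B M) (I : Ideal B) (n : ℕ) {y : B} (hy : y ∈ I ^ (n + 1)) :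
    D y ∈ I ^ n • (⊤ : Submodule B M) := by
  induction n generalizing y with
  | zero => simp
  | succ n ih =>
    rw [pow_succ] at hy
    refine Submodule.mul_induction_on hy (fun a ha b hb => ?_) (fun a b ha hb => ?_)
    · rw [Derivation.leibniz]
      refine Submodule.add_mem _ ?_ ?_
      · exact Submodule.smul_mem_smul ha Submodule.mem_top
      · have h := Submodule.smul_mem_smul hb (ih ha)
        rwa [← Submodule.mul_smul, ← pow_succ'] at h
    · rw [map_add]
      exact Submodule.add_mem _ ha hb

/-! ## Local `K`-algebras with residue field `K`: generators of `Ω_{B/K}` -/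

section Rational

variable {K : Type u} {B : Type v} [CommRing K] [CommRing B] [Algebra K B] [IsLocalRing B]

/-- If every element of the local `K`-algebra `B` is a scalar plus an element of `𝔪` (i.e. the
residue field is `K`) and `𝔪 = (gᵢ)ᵢ`, then `Ω_{B/K} = Σᵢ B dgᵢ + 𝔪 Ω_{B/K}`: for
`b = λ + Σ aᵢ gᵢ`, `db = Σ aᵢ dgᵢ + Σ gᵢ daᵢ`. [folklore] -/
theorem KaehlerDifferential.span_range_D_sup_smul_top_of_maximalIdeal_eq_span
    (hK : ∀ b : B, ∃ c : K, b - algebraMap K B c ∈ maximalIdeal B) {ι : Type w} (g : ι → B)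
    (hg : maximalIdeal B = Ideal.span (Set.range g)) :
    Submodule.span B (Set.range fun i => KaehlerDifferential.D K B (g i)) ⊔
      maximalIdeal B • ⊤ = (⊤ : Submodule B (Ω[B⁄K])) := by
  set N := Submodule.span B (Set.range fun i => KaehlerDifferential.D K B (g i)) with hN
  suffices hD : ∀ b : B, KaehlerDifferential.D K B b ∈ N ⊔ maximalIdeal B • ⊤ by
    have hle : Submodule.span B (Set.range (KaehlerDifferential.D K B)) ≤
        N ⊔ maximalIdeal B • ⊤ := Submodule.span_le.mpr (by rintro _ ⟨b, rfl⟩; exact hD b)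
    rw [KaehlerDifferential.span_range_derivation] at hle
    exact eq_top_iff.mpr hle
  intro b
  obtain ⟨c, hc⟩ := hK b
  have hb : KaehlerDifferential.D K B b = KaehlerDifferential.D K B (b - algebraMap K B c) := by
    rw [map_sub, Derivation.map_algebraMap, sub_zero]
  rw [hb]
  generalize b - algebraMap K B c = x at hc
  rw [hg] at hc
  induction hc using Submodule.span_induction with
  | mem x hx =>
    obtain ⟨i, rfl⟩ := hx
    exact Submodule.mem_sup_left (Submodule.subset_span ⟨i, rfl⟩)
  | zero => simp
  | add x y _ _ hx hy =>
    rw [map_add]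
    exact Submodule.add_mem _ hx hy
  | smul a x hx hx' =>
    rw [smul_eq_mul, Derivation.leibniz]
    refine Submodule.add_mem _ (Submodule.smul_mem _ _ hx') ?_
    refine Submodule.mem_sup_right (Submodule.smul_mem_smul ?_ Submodule.mem_top)
    rw [hg]
    exact hx

/-- With `Ω_{B/K}` finite (e.g. `B` essentially of finite type over `K`), Nakayama's lemma
upgrades the previous statement to **`Ω_{B/K} = Σᵢ B dgᵢ`** for any generators `gᵢ` of `𝔪`.
[folklore] -/
theorem KaehlerDifferential.span_range_D_eq_top_of_maximalIdeal_eq_span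
    [Module.Finite B (Ω[B⁄K])]
    (hK : ∀ b : B, ∃ c : K, b - algebraMap K B c ∈ maximalIdeal B) {ι : Type w} (g : ι → B)
    (hg : maximalIdeal B = Ideal.span (Set.range g)) :
    Submodule.span B (Set.range fun i => KaehlerDifferential.D K B (g i)) =
      (⊤ : Submodule B (Ω[B⁄K])) := by
  have h := KaehlerDifferential.span_range_D_sup_smul_top_of_maximalIdeal_eq_span hK g hg
  refine top_le_iff.mp (Submodule.le_of_le_smul_of_le_jacobson_bot Module.Finite.fg_top
    (maximalIdeal_le_jacobson _) ?_)
  rw [h]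

/-- **`Fitt_k(Ω_{B/K}) = B` if `𝔪` is generated by `k` elements** (local `K`-algebra with residue
field `K`, `Ω_{B/K}` finite): `Ω_{B/K}` is then generated by the `k` elements `dgᵢ` (Stacks 07Z6:
"`Fitt_k(M) = R` if `M` can be generated by `k` elements"). For `k = 1` — a nonsingular point of a
curve over an algebraically closed field, `𝔪 = (t)` — the point is not in `Sing = V(Fitt₁ Ω)`.
[cite: StacksProject, Tag 0C4D] -/
theorem Module.fittingIdeal_kaehler_eq_top_of_maximalIdeal_eq_span [Module.Finite B (Ω[B⁄K])]
    (hK : ∀ b : B, ∃ c : K, b - algebraMap K B c ∈ maximalIdeal B) {k : ℕ} (g : Fin k → B)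
    (hg : maximalIdeal B = Ideal.span (Set.range g)) :
    Module.fittingIdeal B (Ω[B⁄K]) k = ⊤ :=
  Module.fittingIdeal_eq_top_of_span_eq_top (fun i => KaehlerDifferential.D K B (g i))
    (KaehlerDifferential.span_range_D_eq_top_of_maximalIdeal_eq_span hK g hg)

/-- `{u, v}` as the range of `![u, v]`. [folklore] -/
theorem Set.range_vecCons_vecCons_eq_pair {α : Type u} (u v : α) :
    Set.range ![u, v] = {u, v} := by
  ext w
  simp only [Set.mem_range, Set.mem_insert_iff, Set.mem_singleton_iff]
  constructor
  · rintro ⟨i, rfl⟩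
    fin_cases i <;> simp
  · rintro (rfl | rfl)
    exacts [⟨0, rfl⟩, ⟨1, rfl⟩]

/-- **Approximate node coordinates force `𝔪 ⊆ Fitt₁(Ω_{B/K})`.** Let `(B, 𝔪)` be a Noetherian
local `K`-algebra with residue field `K` and `Ω_{B/K}` finite, and suppose that for every `n`
there are `u, v ∈ B` with `𝔪 = (u, v)` and `uv ∈ 𝔪ⁿ` (as at an ordinary double point,
`exists_approxNode_of_ringEquiv_adicCompletion`). Then `𝔪 ⊆ Fitt₁(Ω_{B/K})`: `Ω = B du + B dv`,
`u dv + v du = d(uv) ∈ 𝔪ⁿ⁻¹Ω` gives a relation `(v - α) du + (u - β) dv = 0` with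
`α, β ∈ 𝔪ⁿ⁻¹`, whose `1 × 1` minors lie in `Fitt₁`; hence `𝔪 ⊆ Fitt₁ + 𝔪ⁿ⁻¹` for all `n`, and
Krull's intersection theorem in `B/Fitt₁` concludes. This is The Stacks Project, Tag 0C4D
(1) ⇒ (4) ("the first Fitting ideal of `Ω_{X/k}` generates `𝔪_x`") over an algebraically closed
field, for the tree's completion-based notion of node. [cite: StacksProject, Tag 0C4D] -/
theorem maximalIdeal_le_fittingIdeal_kaehler_of_approxNode [IsNoetherianRing B]
    [Module.Finite B (Ω[B⁄K])]
    (hK : ∀ b : B, ∃ c : K, b - algebraMap K B c ∈ maximalIdeal B)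
    (h : ∀ n : ℕ, ∃ u v : B, maximalIdeal B = Ideal.span {u, v} ∧ u * v ∈ maximalIdeal B ^ n) :
    maximalIdeal B ≤ Module.fittingIdeal B (Ω[B⁄K]) 1 := by
  set J := Module.fittingIdeal B (Ω[B⁄K]) 1 with hJ
  -- Step 1: `𝔪 ⊆ J + 𝔪ⁿ` for every `n`
  have key : ∀ n : ℕ, maximalIdeal B ≤ J ⊔ maximalIdeal B ^ n := by
    intro n
    obtain ⟨u, v, huv, hprod⟩ := h (n + 1)
    let x : Fin (1 + 1) → Ω[B⁄K] := ![KaehlerDifferential.D K B u, KaehlerDifferential.D K B v]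
    have hx : Submodule.span B (Set.range x) = ⊤ := by
      have := KaehlerDifferential.span_range_D_eq_top_of_maximalIdeal_eq_span hK ![u, v]
        (by rw [huv, Set.range_vecCons_vecCons_eq_pair])
      have hfun : (fun i => KaehlerDifferential.D K B (![u, v] i)) = x := by
        ext i
        fin_cases i <;> simp [x]
      rwa [hfun] at this
    -- `d(uv) ∈ 𝔪ⁿ Ω = 𝔪ⁿ (B du + B dv)`
    have hd : KaehlerDifferential.D K B (u * v) ∈
        maximalIdeal B ^ n • Submodule.span B (Set.range x) := by
      rw [hx]
      exact Derivation.apply_mem_pow_smul_top _ _ n hprod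
    obtain ⟨a, ha, hsum⟩ :=
      (Submodule.mem_ideal_smul_span_iff_exists_sum (maximalIdeal B ^ n) x _).mp hd
    have hsum' : a 0 • KaehlerDifferential.D K B u + a 1 • KaehlerDifferential.D K B v =
        u • KaehlerDifferential.D K B v + v • KaehlerDifferential.D K B u := by
      rw [← Derivation.leibniz, ← hsum, Finsupp.sum_fintype _ _ (fun i => zero_smul B (x i)),
        Fin.sum_univ_two]
      rfl
    -- the relation `(v - a₀) du + (u - a₁) dv = 0`
    let ρ : Fin 1 → Fin (1 + 1) → B := fun _ => ![v - a 0, u - a 1]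
    have hρ : ∀ i, ∑ l, ρ i l • x l = 0 := by
      intro i
      rw [Fin.sum_univ_two]
      change (v - a 0) • KaehlerDifferential.D K B u + (u - a 1) • KaehlerDifferential.D K B v = 0
      rw [sub_smul, sub_smul]
      calc v • KaehlerDifferential.D K B u - a 0 • KaehlerDifferential.D K B u +
            (u • KaehlerDifferential.D K B v - a 1 • KaehlerDifferential.D K B v)
          = (u • KaehlerDifferential.D K B v + v • KaehlerDifferential.D K B u) -
            (a 0 • KaehlerDifferential.D K B u + a 1 • KaehlerDifferential.D K B v) := by abel
        _ = 0 := by rw [hsum', sub_self]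
    -- its `1 × 1` minors lie in `Fitt₁`
    have hmem : ∀ l : Fin (1 + 1), ρ 0 l ∈ J := by
      intro l
      have := Module.det_mem_fittingIdeal x hx ρ hρ ⟨fun _ => l, fun i j _ => Subsingleton.elim i j⟩
      rwa [Matrix.det_unique] at this
    have hu : u ∈ J ⊔ maximalIdeal B ^ n := by
      have h1 : u - a 1 ∈ J := hmem 1
      have : u = (u - a 1) + a 1 := by ring
      rw [this]
      exact Submodule.add_mem _ (Submodule.mem_sup_left h1) (Submodule.mem_sup_right (ha 1))
    have hv : v ∈ J ⊔ maximalIdeal B ^ n := by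
      have h0 : v - a 0 ∈ J := hmem 0
      have : v = (v - a 0) + a 0 := by ring
      rw [this]
      exact Submodule.add_mem _ (Submodule.mem_sup_left h0) (Submodule.mem_sup_right (ha 0))
    have hle : Ideal.span {u, v} ≤ J ⊔ maximalIdeal B ^ n := by
      rw [Ideal.span_le]
      rintro w (rfl | rfl)
      · exact hu
      · exact hv
    exact huv.le.trans hle
  -- Step 2: Krull's intersection theorem in `B/J`: `⋂ₙ 𝔪ⁿ(B/J) = 0`
  intro m hm
  have hinf : (⨅ i : ℕ, maximalIdeal B ^ i • ⊤ : Submodule B (B ⧸ J)) = ⊥ :=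
    Ideal.iInf_pow_smul_eq_bot_of_le_jacobson _ (maximalIdeal_le_jacobson _)
  have hmk : Ideal.Quotient.mk J m ∈ (⨅ i : ℕ, maximalIdeal B ^ i • ⊤ : Submodule B (B ⧸ J)) := by
    rw [Submodule.mem_iInf]
    intro i
    obtain ⟨j, hj, y, hy, rfl⟩ := Submodule.mem_sup.mp (key i hm)
    rw [map_add, Ideal.Quotient.eq_zero_iff_mem.mpr hj, zero_add, ← Ideal.Quotient.algebraMap_eq,
      Algebra.algebraMap_eq_smul_one]
    exact Submodule.smul_mem_smul hy Submodule.mem_top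
  rw [hinf, Submodule.mem_bot] at hmk
  exact Ideal.Quotient.eq_zero_iff_mem.mp hmk

end Rational

/-! ## Approximate node coordinates from the complete local ring `K⟦u, v⟧/(uv)` -/

section Completion

variable {K : Type u} [Field K] {B : Type v} [CommRing B] [IsLocalRing B] [IsNoetherianRing B]

/-- Membership in `𝔪ᵏ B̂` is tested on `B̂ → B/𝔪ᵏ`. [folklore] -/
theorem AdicCompletion.mem_map_pow_maximalIdeal_iff (k : ℕ)
    (z : AdicCompletion (maximalIdeal B) B) :
    z ∈ (maximalIdeal B ^ k).map (algebraMap B (AdicCompletion (maximalIdeal B) B)) ↔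
      AdicCompletion.evalₐ (maximalIdeal B) k z = 0 := by
  rw [← Submodule.restrictScalars_mem B, ← Ideal.smul_top_eq_map,
    AdicCompletion.pow_smul_top_eq_ker_eval (IsNoetherian.noetherian _), LinearMap.mem_ker]
  have h : (maximalIdeal B ^ k • ⊤ : Ideal B) = maximalIdeal B ^ k := by
    rw [Ideal.smul_eq_mul, Ideal.mul_top]
  constructor
  · intro hz
    rw [← AdicCompletion.factor_eval_eq_evalₐ (maximalIdeal B) z h.le, hz, map_zero]
  · intro hz
    rw [← AdicCompletion.factor_evalₐ_eq_eval (maximalIdeal B) z h.ge, hz, map_zero]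

/-- `b ∈ 𝔪ᵏ ↔ b ∈ 𝔪ᵏ B̂` (`B/𝔪ᵏ = B̂/𝔪ᵏB̂`). [folklore] -/
theorem AdicCompletion.algebraMap_mem_map_pow_maximalIdeal_iff (k : ℕ) (b : B) :
    algebraMap B (AdicCompletion (maximalIdeal B) B) b ∈
        (maximalIdeal B ^ k).map (algebraMap B (AdicCompletion (maximalIdeal B) B)) ↔
      b ∈ maximalIdeal B ^ k := by
  rw [AdicCompletion.mem_map_pow_maximalIdeal_iff, AdicCompletion.algebraMap_apply,
    Algebra.algebraMap_self, RingHom.id_apply, AdicCompletion.evalₐ_of,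
    Ideal.Quotient.eq_zero_iff_mem]

/-- Density of `B` in `B̂`: every `z ∈ B̂` is congruent to an element of `B` modulo `𝔪ᵏB̂`.
[folklore] -/
theorem AdicCompletion.exists_sub_algebraMap_mem_map_pow (k : ℕ)
    (z : AdicCompletion (maximalIdeal B) B) :
    ∃ b : B, z - algebraMap B (AdicCompletion (maximalIdeal B) B) b ∈
      (maximalIdeal B ^ k).map (algebraMap B (AdicCompletion (maximalIdeal B) B)) := by
  obtain ⟨b, hb⟩ := Ideal.Quotient.mk_surjective (AdicCompletion.evalₐ (maximalIdeal B) k z)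
  refine ⟨b, ?_⟩
  rw [AdicCompletion.mem_map_pow_maximalIdeal_iff, map_sub, AdicCompletion.algebraMap_apply,
    Algebra.algebraMap_self, RingHom.id_apply, AdicCompletion.evalₐ_of, hb, sub_self]

open MvPowerSeries in
/-- A power series in `X₀, X₁` without constant term lies in `(X₀, X₁)`: split its monomials
according to whether `X₀` occurs (`MvPowerSeries.X_dvd_iff`). [folklore] -/
theorem MvPowerSeries.mem_span_X_pair_of_constantCoeff_eq_zero {R : Type u} [CommRing R]
    {φ : MvPowerSeries (Fin 2) R} (hφ : MvPowerSeries.constantCoeff φ = 0) :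
    φ ∈ Ideal.span {(X 0 : MvPowerSeries (Fin 2) R), X 1} := by
  classical
  -- `ψ₀`: the monomials of `φ` containing `X₀`; `ψ₁`: the others
  let ψ₀ : MvPowerSeries (Fin 2) R := fun e => if e 0 = 0 then 0 else MvPowerSeries.coeff e φ
  let ψ₁ : MvPowerSeries (Fin 2) R := fun e => if e 0 = 0 then MvPowerSeries.coeff e φ else 0
  have h₀ : ∀ e, MvPowerSeries.coeff e ψ₀ = if e 0 = 0 then 0 else MvPowerSeries.coeff e φ :=
    fun e => rfl
  have h₁ : ∀ e, MvPowerSeries.coeff e ψ₁ = if e 0 = 0 then MvPowerSeries.coeff e φ else 0 :=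
    fun e => rfl
  have hsum : φ = ψ₀ + ψ₁ := by
    ext e
    rw [map_add, h₀, h₁]
    split_ifs <;> simp
  have hd₀ : (X 0 : MvPowerSeries (Fin 2) R) ∣ ψ₀ :=
    MvPowerSeries.X_dvd_iff.mpr fun m hm => by rw [h₀, if_pos hm]
  have hd₁ : (X 1 : MvPowerSeries (Fin 2) R) ∣ ψ₁ :=
    MvPowerSeries.X_dvd_iff.mpr fun m hm => by
      rw [h₁]
      split_ifs with hm0
      · have : m = 0 := by
          ext i
          fin_cases i
          · exact hm0
          · exact hm
        rw [this, MvPowerSeries.coeff_zero_eq_constantCoeff_apply, hφ]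
      · rfl
  rw [hsum]
  refine Ideal.add_mem _ ?_ ?_
  · exact Ideal.mem_span_pair.mpr (by obtain ⟨q, hq⟩ := hd₀; exact ⟨q, 0, by rw [hq]; ring⟩)
  · exact Ideal.mem_span_pair.mpr (by obtain ⟨q, hq⟩ := hd₁; exact ⟨0, q, by rw [hq]; ring⟩)

variable (K) in
/-- The maximal ideal of `K⟦X₀, X₁⟧` over a field is `(X₀, X₁)`. [folklore] -/
theorem maximalIdeal_mvPowerSeries_fin_two_eq_span :
    maximalIdeal (MvPowerSeries (Fin 2) K) =
      Ideal.span {(MvPowerSeries.X 0 : MvPowerSeries (Fin 2) K), MvPowerSeries.X 1} := by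
  apply le_antisymm
  · intro φ hφ
    rw [mem_maximalIdeal, mem_nonunits_iff, MvPowerSeries.isUnit_iff_constantCoeff] at hφ
    have h0 : MvPowerSeries.constantCoeff φ = 0 := by
      by_contra h
      exact hφ (Ne.isUnit h)
    exact MvPowerSeries.mem_span_X_pair_of_constantCoeff_eq_zero h0
  · rw [Ideal.span_le]
    rintro _ (rfl | rfl) <;>
    · rw [SetLike.mem_coe, mem_maximalIdeal, mem_nonunits_iff,
        MvPowerSeries.isUnit_iff_constantCoeff, MvPowerSeries.constantCoeff_X]
      exact not_isUnit_zero

/-- **Approximate node coordinates at an ordinary double point.** Let `(B, 𝔪)` be a Noetherian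
local ring whose `𝔪`-adic completion `B̂` is isomorphic AS A RING to `K⟦u, v⟧/(uv)` (the tree's
`IsOrdinaryDoublePoint`, de Jong 1996, 2.23: "`B/𝔪_A B ≅ k'⟦u, v⟧/(q)` … we may choose
`q = uv`"). Then for every `n` there are `u, v ∈ B` with `𝔪 = (u, v)` and `uv ∈ 𝔪ⁿ`: the
images `u', v'` of `u, v` in `B̂` satisfy `u'v' = 0` and generate `𝔪_{B̂} = 𝔪B̂`; approximate them
modulo `𝔪ⁿB̂` by elements `u, v ∈ B` (`B/𝔪ⁿ = B̂/𝔪ⁿB̂`); then `uv ∈ 𝔪ⁿB̂ ∩ B = 𝔪ⁿ` and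
`𝔪 ⊆ (u, v) + 𝔪²`, so `𝔪 = (u, v)` by Nakayama. [cite: DeJong1996, 2.23, pp. 61–62] -/
theorem exists_approxNode_of_ringEquiv_adicCompletion
    (e : AdicCompletion (maximalIdeal B) B ≃+*
      MvPowerSeries (Fin 2) K ⧸
        Ideal.span {(MvPowerSeries.X 0 * MvPowerSeries.X 1 : MvPowerSeries (Fin 2) K)})
    (n : ℕ) : ∃ u v : B, maximalIdeal B = Ideal.span {u, v} ∧ u * v ∈ maximalIdeal B ^ n := by
  -- WLOG `n ≥ 2`
  suffices H : ∀ n, 2 ≤ n →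
      ∃ u v : B, maximalIdeal B = Ideal.span {u, v} ∧ u * v ∈ maximalIdeal B ^ n by
    obtain ⟨u, v, h1, h2⟩ := H (n + 2) (by omega)
    exact ⟨u, v, h1, Ideal.pow_le_pow_right (by omega) h2⟩
  intro n hn
  set P : Ideal (MvPowerSeries (Fin 2) K) :=
    Ideal.span {(MvPowerSeries.X 0 * MvPowerSeries.X 1 : MvPowerSeries (Fin 2) K)} with hP
  haveI : IsLocalRing (MvPowerSeries (Fin 2) K ⧸ P) := e.isLocalRing
  -- the node coordinates in `B̂`
  obtain ⟨u', hu'⟩ : ∃ u' : AdicCompletion (maximalIdeal B) B,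
      u' = e.symm (Ideal.Quotient.mk P (MvPowerSeries.X 0)) := ⟨_, rfl⟩
  obtain ⟨v', hv'⟩ : ∃ v' : AdicCompletion (maximalIdeal B) B,
      v' = e.symm (Ideal.Quotient.mk P (MvPowerSeries.X 1)) := ⟨_, rfl⟩
  have huv' : u' * v' = 0 := by
    rw [hu', hv', ← map_mul, ← map_mul,
      Ideal.Quotient.eq_zero_iff_mem.mpr (show _ ∈ P from Ideal.subset_span rfl), map_zero]
  -- `𝔪_{B̂} = (u', v')`
  have hmBh : maximalIdeal (AdicCompletion (maximalIdeal B) B) = Ideal.span {u', v'} := by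
    have h1 : maximalIdeal (MvPowerSeries (Fin 2) K ⧸ P) =
        Ideal.span {Ideal.Quotient.mk P (MvPowerSeries.X 0),
          Ideal.Quotient.mk P (MvPowerSeries.X 1)} := by
      rw [← IsLocalRing.map_maximalIdeal_of_surjective (Ideal.Quotient.mk P)
        Ideal.Quotient.mk_surjective, maximalIdeal_mvPowerSeries_fin_two_eq_span, Ideal.map_span,
        Set.image_pair]
    rw [← IsLocalRing.map_ringEquiv_maximalIdeal e.symm, h1, Ideal.map_span, Set.image_pair,
      hu', hv']
  have hu'm : u' ∈ maximalIdeal (AdicCompletion (maximalIdeal B) B) :=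
    hmBh ▸ Ideal.subset_span (by simp)
  have hv'm : v' ∈ maximalIdeal (AdicCompletion (maximalIdeal B) B) :=
    hmBh ▸ Ideal.subset_span (by simp)
  -- `𝔪ᵏ B̂ = 𝔪_{B̂}ᵏ`
  have hM : ∀ k, (maximalIdeal B ^ k).map (algebraMap B (AdicCompletion (maximalIdeal B) B)) =
      maximalIdeal (AdicCompletion (maximalIdeal B) B) ^ k := fun k => by
    rw [Ideal.map_pow, ← AdicCompletion.maximalIdeal_eq_map]
  -- approximate `u', v'` modulo `𝔪ⁿ B̂` by elements of `B`
  obtain ⟨u, hu⟩ := AdicCompletion.exists_sub_algebraMap_mem_map_pow n u'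
  obtain ⟨v, hv⟩ := AdicCompletion.exists_sub_algebraMap_mem_map_pow n v'
  rw [hM] at hu hv
  have hn0 : n ≠ 0 := by omega
  refine ⟨u, v, le_antisymm ?_ ?_, ?_⟩
  · -- Nakayama: `𝔪 ⊆ (u, v) + 𝔪²`
    refine Submodule.le_of_le_smul_of_le_jacobson_bot (IsNoetherian.noetherian _)
      (maximalIdeal_le_jacobson _) ?_
    intro y hy
    have hy' : algebraMap B (AdicCompletion (maximalIdeal B) B) y ∈ Ideal.span {u', v'} := by
      rw [← hmBh, AdicCompletion.maximalIdeal_eq_map]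
      exact Ideal.mem_map_of_mem _ hy
    obtain ⟨a, b, hab⟩ := Ideal.mem_span_pair.mp hy'
    obtain ⟨a₀, ha₀⟩ := AdicCompletion.exists_sub_algebraMap_mem_map_pow 1 a
    obtain ⟨b₀, hb₀⟩ := AdicCompletion.exists_sub_algebraMap_mem_map_pow 1 b
    rw [hM, pow_one] at ha₀ hb₀
    have hmem : y - (a₀ * u + b₀ * v) ∈ maximalIdeal B ^ 2 := by
      rw [← AdicCompletion.algebraMap_mem_map_pow_maximalIdeal_iff, hM]
      have : algebraMap B (AdicCompletion (maximalIdeal B) B) (y - (a₀ * u + b₀ * v)) =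
          (a - algebraMap B _ a₀) * u' + algebraMap B _ a₀ * (u' - algebraMap B _ u) +
            ((b - algebraMap B _ b₀) * v' + algebraMap B _ b₀ * (v' - algebraMap B _ v)) := by
        rw [map_sub, ← hab, map_add, map_mul, map_mul]
        ring
      rw [this]
      have h2 : maximalIdeal (AdicCompletion (maximalIdeal B) B) ^ n ≤
          maximalIdeal (AdicCompletion (maximalIdeal B) B) ^ 2 := Ideal.pow_le_pow_right hn
      refine Ideal.add_mem _ (Ideal.add_mem _ ?_ (Ideal.mul_mem_left _ _ (h2 hu)))
        (Ideal.add_mem _ ?_ (Ideal.mul_mem_left _ _ (h2 hv)))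
      · rw [pow_two]
        exact Ideal.mul_mem_mul ha₀ hu'm
      · rw [pow_two]
        exact Ideal.mul_mem_mul hb₀ hv'm
    have hy_eq : y = (a₀ * u + b₀ * v) + (y - (a₀ * u + b₀ * v)) := by ring
    rw [hy_eq]
    refine Submodule.add_mem _ (Submodule.mem_sup_left (Ideal.mem_span_pair.mpr ⟨a₀, b₀, rfl⟩))
      (Submodule.mem_sup_right ?_)
    rw [Ideal.smul_eq_mul, ← pow_two]
    exact hmem
  · -- `u, v ∈ 𝔪`
    have hmemB : ∀ {w : B} {w' : AdicCompletion (maximalIdeal B) B},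
        w' ∈ maximalIdeal (AdicCompletion (maximalIdeal B) B) →
        w' - algebraMap B _ w ∈ maximalIdeal (AdicCompletion (maximalIdeal B) B) ^ n →
        w ∈ maximalIdeal B := by
      intro w w' hw' hww'
      have h1 : algebraMap B (AdicCompletion (maximalIdeal B) B) w ∈
          maximalIdeal (AdicCompletion (maximalIdeal B) B) := by
        have : algebraMap B (AdicCompletion (maximalIdeal B) B) w = w' - (w' - algebraMap B _ w) := by
          ring
        rw [this]
        exact Ideal.sub_mem _ hw' (Ideal.pow_le_self hn0 hww')
      rw [mem_maximalIdeal, mem_nonunits_iff] at h1 ⊢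
      rwa [isUnit_map_iff] at h1
    rw [Ideal.span_le]
    rintro w (rfl | rfl)
    · exact hmemB hu'm hu
    · exact hmemB hv'm hv
  · -- `uv ∈ 𝔪ⁿ`
    rw [← AdicCompletion.algebraMap_mem_map_pow_maximalIdeal_iff, hM, map_mul]
    have : algebraMap B (AdicCompletion (maximalIdeal B) B) u * algebraMap B _ v =
        u' * v' - u' * (v' - algebraMap B _ v) - (u' - algebraMap B _ u) * v' +
          (u' - algebraMap B _ u) * (v' - algebraMap B _ v) := by ring
    rw [this, huv', zero_sub]
    exact Ideal.add_mem _ (Ideal.sub_mem _ (Submodule.neg_mem _ (Ideal.mul_mem_left _ _ hv))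
      (Ideal.mul_mem_right _ _ hu)) (Ideal.mul_mem_right _ _ hu)

/-- **Stacks 0C4D (1) ⇒ (4) over an algebraically closed field, completion form**: for a
Noetherian local `K`-algebra `(B, 𝔪)` with residue field `K` (every `b` is `λ + x`, `λ ∈ K`,
`x ∈ 𝔪`), `Ω_{B/K}` finite, and `B̂ ≃+* K⟦u, v⟧/(uv)` as rings, the first Fitting ideal of
`Ω_{B/K}` contains `𝔪` ("the first Fitting ideal of `Ω_{X/k}` generates `𝔪_x` in `𝒪_{X,x}`";
the reverse inclusion holds as soon as `Fitt₁ ≠ B`). [cite: StacksProject, Tag 0C4D] -/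
theorem maximalIdeal_le_fittingIdeal_kaehler_of_ringEquiv_adicCompletion [Algebra K B]
    [Module.Finite B (Ω[B⁄K])]
    (hK : ∀ b : B, ∃ c : K, b - algebraMap K B c ∈ maximalIdeal B)
    (e : AdicCompletion (maximalIdeal B) B ≃+*
      MvPowerSeries (Fin 2) K ⧸
        Ideal.span {(MvPowerSeries.X 0 * MvPowerSeries.X 1 : MvPowerSeries (Fin 2) K)}) :
    maximalIdeal B ≤ Module.fittingIdeal B (Ω[B⁄K]) 1 :=
  maximalIdeal_le_fittingIdeal_kaehler_of_approxNode hK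
    (exists_approxNode_of_ringEquiv_adicCompletion e)

end Completion

end Literature.AlgebraicGeometry.Resolution
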